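import Literature.NumberTheory.EllipticCurves.ZpExtensionEisensteinTwistRestrictedDualityInstanceProofs
import Literature.NumberTheory.GaloisCohomology.Howard2004.DualityDatumRestrictedPairingFlipProofs
import Literature.NumberTheory.EllipticCurves.ZpExtensionEisensteinTwistDualityFormNondegenerateProofs
import Literature.NumberTheory.EllipticCurves.ZpExtensionEisensteinDVRSetting
import HarnessLib

/-!
# H.4 at `v ∣ p` for the curve's Eisenstein tower: the FLIPPED restricted local pairing
# `H¹(K_v, W_{k+1} / Fil_v W_{k+1}) × H¹(K_v, δ_v·Fil_{σv} W_{k+1}) → H²(K_v, A_{m,k+1}(1))` exists and is non-degenerate on both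
# sides (TURNKEY; theorems only; no definition, no named fact, no instance, no `sorry`)

Topic `NumberTheory/EllipticCurves` (cell `pub/bsd-print-x9`; brick (B3♭) of `HOME/p1/H4-EXACT-AT-P-PLAN` — the X/Y-flipped twin of
`ZpExtensionEisensteinDVRSettingH4RestrictedPairingProofs` ((B3), `eisensteinTower_restrictedPairing_nondegenerate`), needed for the
second (Exact) clause of the (B6) limit-exactness step at `v ∣ p` of Howard's H.4 for `F_𝔮` (both orientations of
`Tower.levelCondition_mem_iff_forall_pairing_eq_zero`).

Howard [Compositio Math. 140 (2004), §1.3 H.4, Lemma 3.1.1, Def. 3.2.6; arXiv:1202.6340 p. 7 L69–82, p. 15 L56–62, p. 16 L108–110]: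
at `v ∣ p`, `Fil_v T_𝔮` is its own exact orthogonal complement under `e_𝔮`, so `e_𝔮` induces perfect pairings
`Fil_v × Tw/Fil′ → S(1)` AND `T/Fil_v × Fil′ → S(1)`; the local conditions are exact orthogonal complements under the local Tate
pairing.  For the D-family's level-`k` datum `D` on `W_{k+1} = E_K[p^{k+1}] ⊗ A_{m,k+1}(ψ)`
(`κ.eisensteinTwist E_K[p^{k+1}] hm (k+1) = (W.eisensteinTower κ hm).ρ k` by `rfl`) with `D.e = eisensteinDualityForm hm (k+1) (conjPairing e τ_* log)`:

* **`WeierstrassCurve.eisensteinTower_restrictedPairing_flip_nondegenerate`** — in the SAME binders as the (B3) turnkey (the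
  (HY-FRAMES) facts on `e`/`log`/`τ_*`, `IsOrdinaryAt W p`, `p ∈ v`, the plus part `V = A ⊗ Fil_v E[p^{k+1}]` and the transported
  plus part `V′ = W_{k+1}(δ_v) · (A ⊗ Fil_{σv} E[p^{k+1}])` with their stability proofs `hV`/`hV′`): there is a flipped restricted
  pairing `P♭` on the tree's carriers `(GaloisRep.toLocal v _).quotient V hV` × `(GaloisRep.toLocal v (cd.twist _)).subrepresentation V′ hV′`
  with `P♭([s], t) = D.e s t`, and BOTH kernels of `P♭.cupProduct` are trivial.
  Chain: `DualityDatum.exists_restrictedPairing_flip` + `restrictedPairing_flip_eq_zero_of_forall_cupProduct_eq_zero_right/left`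
  (`Howard2004/DualityDatumRestrictedPairingFlipProofs`, PROVED local duality; module-level perfectness of the flip is derived
  there from (hN) right non-degeneracy of `λ ∘ D.e` and (hR) `Fil_v^⊥ ⊆ Fil′` by counting) ∘
  `eisensteinDualityForm_torsionFilAt_restricted_perfect_of_isOrdinaryAt` ((horth), (hR)) + `ZpExtension.map_eisensteinTwist_span_tmul`
  + (hN) from the datum itself (`ZpExtension.nondegenerate_of_dualityDatum_e_eq`, fields `perfect`/`symm`) lifted to the twisted
  module by `ZpExtension.mem_span_tmul_of_forall_tailFormZMod_eisensteinDualityForm_eq_zero` (`Fil₁ = ⊤`, `Fil₂ = ⊥`), with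
  `λ = tailFormZMod`, `exp = log⁻¹`.

No summit statement is proved; BSD is not proved by any of this.  Seat `bsd-line-x10b-p1-w7` g2.

References: [Howard2004HeegnerKolyvagin] §1.3 H.4, Lemma 2.1.1, §3.1, Lemma 3.1.1, Def. 3.2.6 (arXiv:1202.6340 p. 7, p. 15, p. 16);
[MilneADT2006] I §0 Prop. 0.19, I Cor. 2.3; [SerreGaloisCohomology1997] II §5.2 Thm. 2; [GreenbergLNM1716] §2.
-/
set_option autoImplicit false

noncomputable section

open scoped TensorProduct ContRepresentation NumberField
open Function NumberField IsDedekindDomain Field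

namespace WeierstrassCurve

open Literature.NumberTheory.EllipticCurves Literature.NumberTheory.GaloisRepresentations
open Literature.NumberTheory.GaloisRepresentations.DiscreteGaloisModule
open Literature.NumberTheory.GaloisCohomology.Howard2004 Literature.NumberTheory.EllipticCurves.IwasawaAlgebra
open Literature.NumberTheory.EllipticCurves.ZpExtension

variable {K : Type} [Field K] [NumberField K] (W : WeierstrassCurve ℚ) [W.IsElliptic] [W.IsGloballyMinimal] {p : ℕ}
  [hp : Fact p.Prime] (κ : ZpExtension K p) {m : ℕ} (hm : 1 ≤ m)
  (σ : K ≃ₐ[ℚ] K) (hσ₁ : σ ≠ 1) (hσ : σ * σ = 1) (τ : AlgebraicClosure K ≃+* AlgebraicClosure K)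
  (hτ : IsLiftOfAut σ τ) (hτ₂ : Function.Involutive τ)

/-- **The FLIPPED restricted local pairing of H.4 at `v ∣ p` for the curve's Eisenstein tower exists and is non-degenerate on both
sides** (TURNKEY for the second (Exact)-at-`p` descent): see the module docstring.  `V`/`V′` are the plus part at `v` and the
`δ_v`-transport of the plus part at `σ v` of the level `W_{k+1} = κ.eisensteinTwist E_K[p^{k+1}] hm (k+1)` (`= (W.eisensteinTower κ hm).ρ k`,
`rfl`), given by their defining equations `hVdef`/`hV'def` (pass `rfl`) for ANY presentation `t, ht` of the transitions, with their
stability proofs `hV`, `hV′` supplied by the caller (`OrdinaryFiltration.twistedFil_le_comap`, `ConjugationDatum.map_delta_le_comap_twist`);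
the pairing lives on `H¹(K_v, W_{k+1}/V) × H¹(K_v, V′)`.
[cite: Howard2004HeegnerKolyvagin, §1.3 H.4, Lemma 3.1.1 and Def. 3.2.6 (arXiv:1202.6340 p. 7 L78–82, p. 15 L60–62, p. 16 L108–110)]
[cite: MilneADT2006, I Cor. 2.3] [cite: SerreGaloisCohomology1997, II §5.2 Thm. 2] -/
theorem eisensteinTower_restrictedPairing_flip_nondegenerate (hordW : IsOrdinaryAt W p) (v : HeightOneSpectrum (𝓞 K))
    (hpv : ((p : ℕ) : 𝓞 K) ∈ v.asIdeal) [CharZero (v.adicCompletion K)] (k : ℕ)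
    (t : ∀ j, ((W.baseChange K).torsionGaloisModule ((p : ℤ) ^ (j + 1))).toContRepresentation →ⁱL
      ((W.baseChange K).torsionGaloisModule ((p : ℤ) ^ j)).toContRepresentation)
    (ht : ∀ j (P : geomTorsion (W.baseChange K) ((p : ℤ) ^ (j + 1))), t j P = (W.baseChange K).geomTorsionReduce p j P)
    (D : DualityDatum p (ConjugationDatum.ofLifts σ hσ₁ hσ τ hτ hτ₂)
      (κ.eisensteinTwist ((W.baseChange K).torsionGaloisModule ((p : ℤ) ^ (k + 1))) hm (k + 1))
      (EisensteinCoeff p m (k + 1)))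
    (e : geomTorsion (W.baseChange K) ((p : ℤ) ^ (k + 1)) →+ geomTorsion (W.baseChange K) ((p : ℤ) ^ (k + 1)) →+
      MuCarrier K (p ^ (k + 1)))
    (log : MuCarrier K (p ^ (k + 1)) →+ ZMod (p ^ (k + 1)))
    (hDe : D.e = eisensteinDualityForm hm (k + 1) (conjPairing e (hτ.torsionMap W ((p : ℤ) ^ (k + 1))) log))
    (halt : ∀ a, e a a = 0) (hnd : ∀ b, (∀ a, e a b = 0) → b = 0)
    (hθθ : ∀ a : geomTorsion (W.baseChange K) ((p : ℤ) ^ (k + 1)), hτ.torsionMap W _ (hτ.torsionMap W _ a) = a)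
    (hlog : Bijective log)
    (hlogχ : ∀ (g : absoluteGaloisGroup K) ξ, log (mu K (p ^ (k + 1)) g ξ) = cyclotomicCharacterModPow K p (k + 1) g * log ξ)
    (V V' : Submodule ℤ (EisensteinCoeff.Twisted p m (k + 1) (geomTorsion (W.baseChange K) ((p : ℤ) ^ (k + 1)))))
    (hVdef : V = ((W.baseChange K).ordinaryFiltrationAt v t ht).twistedFil (m := m) (k + 1))
    (hV'def : V' = (((W.baseChange K).ordinaryFiltrationAt (σ • v) t ht).twistedFil (m := m) (k + 1)).map
      ((κ.eisensteinTwist ((W.baseChange K).torsionGaloisModule ((p : ℤ) ^ (k + 1))) hm (k + 1))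
        ((ConjugationDatum.ofLifts σ hσ₁ hσ τ hτ hτ₂).δ v)))
    (hV : ∀ g : absoluteGaloisGroup (v.adicCompletion K), V ≤ V.comap
      (GaloisRep.toLocal v (κ.eisensteinTwist ((W.baseChange K).torsionGaloisModule ((p : ℤ) ^ (k + 1))) hm (k + 1)) g))
    (hV' : ∀ g : absoluteGaloisGroup (v.adicCompletion K), V' ≤ V'.comap
      (GaloisRep.toLocal v ((ConjugationDatum.ofLifts σ hσ₁ hσ τ hτ hτ₂).twist
        (κ.eisensteinTwist ((W.baseChange K).torsionGaloisModule ((p : ℤ) ^ (k + 1))) hm (k + 1))) g)) :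
    ∃ P : ContPairing
        ((GaloisRep.toLocal v (κ.eisensteinTwist ((W.baseChange K).torsionGaloisModule ((p : ℤ) ^ (k + 1))) hm
          (k + 1))).quotient V hV).toTopRep
        ((GaloisRep.toLocal v ((ConjugationDatum.ofLifts σ hσ₁ hσ τ hτ hτ₂).twist
          (κ.eisensteinTwist ((W.baseChange K).torsionGaloisModule ((p : ℤ) ^ (k + 1))) hm (k + 1)))).subrepresentation
          V' hV').toTopRep
        (GaloisRep.toLocal v D.twistOne).toTopRep,
      (∀ (s : EisensteinCoeff.Twisted p m (k + 1) (geomTorsion (W.baseChange K) ((p : ℤ) ^ (k + 1)))) (t : V'),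
          P.toLin (Submodule.Quotient.mk s) t = D.e s (t : _)) ∧
      (∀ y, (∀ x, P.cupProduct x y = 0) → y = 0) ∧ (∀ x, (∀ y, P.cupProduct x y = 0) → x = 0) := by
  haveI : NeZero (p ^ (k + 1)) := ⟨pow_ne_zero _ hp.out.ne_zero⟩
  haveI : Finite (geomTorsion (W.baseChange K) ((p : ℤ) ^ (k + 1))) :=
    finite_torsionPoints_holds (W.baseChange K) (AlgebraicClosure K)
      (pow_ne_zero _ (Nat.cast_ne_zero.mpr hp.out.ne_zero))
  haveI : Finite (EisensteinCoeff.Twisted p m (k + 1) (geomTorsion (W.baseChange K) ((p : ℤ) ^ (k + 1)))) :=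
    EisensteinCoeff.finite_twisted hm
  -- the three module-level clauses for `E = eisensteinDualityForm hm (k+1) ẽ` on the spans
  have hclauses := W.eisensteinDualityForm_torsionFilAt_restricted_perfect_of_isOrdinaryAt hm σ hσ₁ hσ τ hτ hτ₂
    hordW v hpv (k + 1) e log hlog.1 halt hnd hθθ
  obtain ⟨horth, hR, -⟩ := hclauses
  -- identify the submodules: `V` is the span (rfl) and `V′` is the span of the `δ_v`-translate
  have hVeq : V = Submodule.span ℤ {x | ∃ (c : EisensteinCoeff p m (k + 1))
      (a : geomTorsion (W.baseChange K) ((p : ℤ) ^ (k + 1))),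
        a ∈ (W.baseChange K).torsionFilAt v ((p : ℤ) ^ (k + 1)) ∧ x = EisensteinCoeff.Twisted.tmul c a} := hVdef
  have hV'eq : V' = Submodule.span ℤ {x | ∃ (c : EisensteinCoeff p m (k + 1))
      (b : geomTorsion (W.baseChange K) ((p : ℤ) ^ (k + 1))),
        b ∈ ((W.baseChange K).torsionFilAt (σ • v) ((p : ℤ) ^ (k + 1))).map
          ((W.baseChange K).torsionGaloisModule ((p : ℤ) ^ (k + 1)) ((ConjugationDatum.ofLifts σ hσ₁ hσ τ hτ hτ₂).δ v)) ∧
        x = EisensteinCoeff.Twisted.tmul c b} := by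
    rw [hV'def]
    exact ZpExtension.map_eisensteinTwist_span_tmul κ ((W.baseChange K).torsionGaloisModule ((p : ℤ) ^ (k + 1))) hm (k + 1)
      ((W.baseChange K).torsionFilAt (σ • v) ((p : ℤ) ^ (k + 1))) ((ConjugationDatum.ofLifts σ hσ₁ hσ τ hτ hτ₂).δ v)
  have horth' : ∀ s ∈ V, ∀ t ∈ V', D.e s t = 0 := by
    intro s hs t ht
    rw [hVeq] at hs
    rw [hV'eq] at ht
    rw [hDe]
    exact horth s hs t ht
  have hP0 := D.exists_restrictedPairing_flip v V hV V' hV' horth'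
  obtain ⟨P, hP⟩ := hP0
  -- the reading `λ = tailFormZMod`, `exp = log⁻¹`
  have hM : ∀ x : EisensteinCoeff.Twisted p m (k + 1) (geomTorsion (W.baseChange K) ((p : ℤ) ^ (k + 1))),
      (p ^ (k + 1)) • x = 0 := fun x ↦ EisensteinCoeff.prime_pow_nsmul_twisted x
  let lam : EisensteinCoeff p m (k + 1) →+ ZMod (p ^ (k + 1)) := (EisensteinCoeff.tailFormZMod p hm (k + 1)).toAddMonoidHom
  have hlam : ∀ (z : ℤ_[p]) (r : EisensteinCoeff p m (k + 1)),
      lam (algebraMap ℤ_[p] (EisensteinCoeff p m (k + 1)) z * r) = PadicInt.toZModPow (k + 1) z * lam r := by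
    intro z r
    change EisensteinCoeff.tailFormZMod p hm (k + 1) _ = _ * EisensteinCoeff.tailFormZMod p hm (k + 1) r
    rw [EisensteinCoeff.algebraMap_padicInt_eq_ofZMod_toZModPow p hm (k + 1), EisensteinCoeff.tailFormZMod_ofZMod_mul]
  let E : MuCarrier K (p ^ (k + 1)) ≃+ ZMod (p ^ (k + 1)) := AddEquiv.ofBijective log hlog
  let exp : ZMod (p ^ (k + 1)) →+ MuCarrier K (p ^ (k + 1)) := E.symm.toAddMonoidHom
  have hexp : ∀ (g : absoluteGaloisGroup K) (x : ZMod (p ^ (k + 1))),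
      exp (cyclotomicCharacterModPow K p (k + 1) g * x) = mu K (p ^ (k + 1)) g (exp x) := by
    intro g x
    apply hlog.1
    have h1 : log (exp x) = x := E.apply_symm_apply x
    have h2 : log (exp (cyclotomicCharacterModPow K p (k + 1) g * x)) = cyclotomicCharacterModPow K p (k + 1) g * x :=
      E.apply_symm_apply _
    rw [hlogχ, h1, h2]
  have hexpb : Bijective exp := E.symm.bijective
  have hR' : ∀ t, (∀ s ∈ V, lam (D.e s t) = 0) → t ∈ V' := by
    intro t ht
    rw [hV'eq]
    refine hR t fun s hs ↦ ?_
    have h := ht s (by rw [hVeq]; exact hs)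
    rw [hDe] at h
    exact h
  -- (hN): `λ ∘ D.e` is right non-degenerate on the whole twisted level (fields `perfect`/`symm` of `D`, lifted from `ẽ`)
  have hN' : ∀ t, (∀ s, lam (D.e s t) = 0) → t = 0 := by
    intro t ht
    have hndr := (ZpExtension.nondegenerate_of_dualityDatum_e_eq hm (k + 1) D
      (conjPairing e (hτ.torsionMap W ((p : ℤ) ^ (k + 1))) log) hDe
      (W.geomTorsion_baseChange_pow_nsmul_eq_zero (K := K) (p := p) (k + 1))).2.2
    have hbot : ∀ b : geomTorsion (W.baseChange K) ((p : ℤ) ^ (k + 1)),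
        (∀ a ∈ (⊤ : Submodule ℤ (geomTorsion (W.baseChange K) ((p : ℤ) ^ (k + 1)))),
          conjPairing e (hτ.torsionMap W ((p : ℤ) ^ (k + 1))) log a b = 0) →
        b ∈ (⊥ : Submodule ℤ (geomTorsion (W.baseChange K) ((p : ℤ) ^ (k + 1)))) := fun b hb ↦ by
      rw [hndr b fun a ↦ hb a Submodule.mem_top]
      exact Submodule.zero_mem _
    have hmem := mem_span_tmul_of_forall_tailFormZMod_eisensteinDualityForm_eq_zero hm (k + 1)
      (conjPairing e (hτ.torsionMap W ((p : ℤ) ^ (k + 1))) log) ⊤ ⊥ hbot t fun s _ ↦ by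
        have h := ht s
        rw [hDe] at h
        exact h
    have hle : Submodule.span ℤ {x | ∃ (c : EisensteinCoeff p m (k + 1))
        (a : geomTorsion (W.baseChange K) ((p : ℤ) ^ (k + 1))),
          a ∈ (⊥ : Submodule ℤ (geomTorsion (W.baseChange K) ((p : ℤ) ^ (k + 1)))) ∧ x = EisensteinCoeff.Twisted.tmul c a} ≤
        ⊥ :=
      Submodule.span_le.mpr fun x hx ↦ by
        obtain ⟨c, a, ha, rfl⟩ := hx
        rw [(Submodule.mem_bot ℤ).mp ha, EisensteinCoeff.Twisted.tmul_zero]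
        exact Submodule.zero_mem _
    exact (Submodule.mem_bot ℤ).mp (hle hmem)
  refine ⟨P, hP, fun y hy ↦ ?_, fun x hx ↦ ?_⟩
  · exact DualityDatum.restrictedPairing_flip_eq_zero_of_forall_cupProduct_eq_zero_right lam hlam exp hexp hexpb P hP hM hN'
      hR' y hy
  · exact DualityDatum.restrictedPairing_flip_eq_zero_of_forall_cupProduct_eq_zero_left lam hlam exp hexp hexpb P hP hM hN'
      hR' x hx

end WeierstrassCurve

end
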